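import Literature.NumberTheory.LFunctions.RiemannSiegelAuxiliary
import Literature.NumberTheory.LFunctions.AriasDeReynaLehmerAssembly
import Mathlib.Analysis.SpecialFunctions.Gamma.Basic
import Mathlib.Analysis.Complex.ExponentialBounds
import HarnessLib

/-!
# Arias de Reyna's bounds for Lehmer's form of the Riemann–Siegel expansion of `𝓡(s)`

Topic `Literature/NumberTheory/LFunctions` (companion of `RiemannSiegelAuxiliary.lean`, which defines
Riemann's auxiliary function `𝓡(s)` = `SiegelIntegral.riemannAux` and the line integrals
`∫_{c↙} x^{-s} e^{πix²}/(e^{πix} − e^{−πix}) dx` = `SiegelIntegral.rsLineIntegral c s`, and of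
`RiemannSiegelIntegralFormula.lean`, which proves the residue shift
`𝓡(s) = Σ_{n ≤ N} n^{-s} + ∫_{N↙N+1}`, `SiegelIntegral.riemannAux_eq_sum_add_rsLineIntegral`).

Arias de Reyna (Math. Comp. 80 (2011)) expands the remaining integral, for `s = σ + it`, `t > 0`,
`a = √(t/2π)`, `N = ⌊a⌋`, `p = 1 − 2(a − N)`, as (Thm. 3.1, "Lehmer's form of the Riemann–Siegel
formula", eq. (3.11))

  `∫_{N↙N+1} x^{-s} e^{πix²}/(e^{πix} − e^{−πix}) dx = (−1)^{N−1} U a^{−σ} (Σ_{k=0}^{K} C_k(p)/a^k + RS_K)`,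
  `U = exp(−i((t/2) log(t/2π) − t/2 − π/8))`,

and proves the explicit bounds `|C_k(p)| ≤ c(σ) Γ(k/2)/b(σ)^k` for `k ≥ 1` (Thm. 4.1, eqs.
(4.1)–(4.3)), `|RS_K| ≤ c₁(σ) Γ((K+1)/2)/(a/1.1)^{K+1}` for `K ≥ 1` and `σ ≥ 0` or `K + σ ≥ 2`
(Thm. 4.2, eqs. (4.7)–(4.8)), and `|C₀(p)| = |F(p)| ≤ 1/2` on `[−1, 1]` (eq. (5.2) and Thm. 6.1 with
`n = 0`). This is the input "Proposition 6.2" of Polymath 15 (Res. Math. Sci. 6 (2019), §6.2) to the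
effective approximation of the heat-flowed Riemann `ξ`-function (Polymath 15, Thm. 1.3; tree:
`Literature.NumberTheory.LFunctions.Polymath15.effective_approximation`).

## Contents

* the constants of the source as definitions: `ariasU` (eq. (3.3)), `ariasC`, `ariasB` (eq. (4.2)),
  `ariasC1` (eq. (4.8));
* the NAMED FACT `arias_lehmer_rs_bound`: Thms. 3.1, 4.1, 4.2 and the bound `|C₀| ≤ 1/2`, stated —
  exactly as Polymath 15, Prop. 6.2/6.3 consume them — EXISTENTIALLY in the coefficients
  `C₀, …, C_K` (the source identifies them: `C₀ = F` of eq. (5.2), `C_k` by eqs. (3.9), (5.1); this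
  identification is not vendored, so the fact is weaker than the source) and on the tree's line
  integral through `N + 1/2` (the source takes any line of direction `e^{−3πi/4}` crossing `[N, N+1]`
  at `a`, with a small semicircle when `a ∈ ℤ`; by Cauchy's theorem — `rsLineIntegral_eq_of_noInt` —
  this is the line through `N + 1/2`; for `N = 0` it is `riemannAux` itself);
* two unfolding lemmas (`ariasC_of_pos`, `ariasC1_of_nonneg`) and `norm_ariasU` (`|U| = 1`).

## What is NOT here

The proofs (§3–§4 of the source: the saddle-point form `g(τ, z)` of the integrand, its Taylor
expansion in `τ = 1/(4√π a)`, Cauchy estimates on the circle `|ζ| = 8/9` resp. `|ζ| → 1` using the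
harmonic minorant `V(e^{iθ}) ≥ 1/2 − log 2`, and the `L¹/L^∞` interpolation along the line `L` for the
remainder), the explicit formulas for `C_k` (§5, Hermite expansion, the recurrences (2.7)–(2.10)) and
the bounds of §6 for the terms of those formulas. The tree's `RiemannSiegelRemainderK0.lean` proves an
explicit bound of the same kind for `σ = 1/2`, `K = 0` only (Gabcke's route).

## References

* J. Arias de Reyna, *High precision computation of Riemann's zeta function by the Riemann–Siegel
  formula, I*, Math. Comp. 80 (2011), no. 274, 995–1009: eqs. (3.1)–(3.4), Thm. 3.1 (eq. (3.11)),
  Thm. 4.1 (eqs. (4.1)–(4.3)), Thm. 4.2 (eqs. (4.7)–(4.8)), eq. (5.2), Thm. 6.1. [AriasDeReyna2011]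
* D. H. J. Polymath, *Effective approximation of heat flow evolution of the Riemann ξ function, and
  a new upper bound for the de Bruijn–Newman constant*, Res. Math. Sci. 6 (2019), Paper 31, §6.2,
  Prop. 6.2 and eq. (cop) `|C₀(p)| ≤ 1/2`. [Polymath2019]
-/

noncomputable section

open Complex

open scoped Real

namespace Literature.NumberTheory.LFunctions

/-! ## The constants of Arias de Reyna 2011 -/

/-- The unimodular factor `U = exp(−i((t/2) log(t/2π) − t/2 − π/8))` of Lehmer's form of the
Riemann–Siegel formula (the Stirling main term of `e^{−iϑ(t)}`), as a function of the height `t > 0`.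
[cite: AriasDeReyna2011, eq. (3.3)] -/
def ariasU (t : ℝ) : ℂ :=
  Complex.exp (-I * (t / 2 * Real.log (t / (2 * π)) - t / 2 - π / 8 : ℝ))

/-- The constant `c(σ)` of Arias de Reyna's bound `|C_k(p)| ≤ c(σ) Γ(k/2)/b(σ)^k` (`k ≥ 1`):
`c(σ) = 9^σ/(√2 π)` for `σ > 0` and `c(σ) = 2^{−σ}/(√2 π)` for `σ ≤ 0` (eq. (4.3):
`(√2/(2π)) 9^σ`, resp. `2^{1/2 − σ}/(2π)`). [cite: AriasDeReyna2011, Thm. 4.1, eq. (4.2)] -/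
def ariasC (σ : ℝ) : ℝ :=
  if 0 < σ then (9 : ℝ) ^ σ / (Real.sqrt 2 * π) else (2 : ℝ) ^ (-σ) / (Real.sqrt 2 * π)

/-- The constant `b(σ)` of Arias de Reyna's bound `|C_k(p)| ≤ c(σ) Γ(k/2)/b(σ)^k` (`k ≥ 1`):
`b(σ) = 2` for `σ > 0` and `b(σ) = √((3 − 2 log 2) π)` for `σ ≤ 0`.
[cite: AriasDeReyna2011, Thm. 4.1, eq. (4.2)] -/
def ariasB (σ : ℝ) : ℝ :=
  if 0 < σ then 2 else Real.sqrt ((3 - 2 * Real.log 2) * π)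

/-- The constant `c₁(σ)` of Arias de Reyna's remainder bound `|RS_K| ≤ c₁ Γ((K+1)/2)/(a/1.1)^{K+1}`:
`c₁ = (1/7) 2^{3σ/2}` for `σ ≥ 0` and `c₁ = (1/2) (9/10)^{⌈−σ⌉}` for `σ < 0`.
[cite: AriasDeReyna2011, Thm. 4.2, eq. (4.8)] -/
def ariasC1 (σ : ℝ) : ℝ :=
  if 0 ≤ σ then 1 / 7 * (2 : ℝ) ^ (3 * σ / 2) else 1 / 2 * (9 / 10 : ℝ) ^ ⌈-σ⌉₊

/-- `c(σ) = 9^σ/(√2 π)` for `σ > 0`. [cite: AriasDeReyna2011, Thm. 4.1, eq. (4.2)] -/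
theorem ariasC_of_pos {σ : ℝ} (hσ : 0 < σ) : ariasC σ = (9 : ℝ) ^ σ / (Real.sqrt 2 * π) := by
  simp [ariasC, hσ]

/-- `c(σ) = 2^{−σ}/(√2 π)` for `σ ≤ 0`. [cite: AriasDeReyna2011, Thm. 4.1, eq. (4.2)] -/
theorem ariasC_of_nonpos {σ : ℝ} (hσ : σ ≤ 0) : ariasC σ = (2 : ℝ) ^ (-σ) / (Real.sqrt 2 * π) := by
  simp [ariasC, not_lt.2 hσ]

/-- `c₁(σ) = (1/7) 2^{3σ/2}` for `σ ≥ 0`. [cite: AriasDeReyna2011, Thm. 4.2, eq. (4.8)] -/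
theorem ariasC1_of_nonneg {σ : ℝ} (hσ : 0 ≤ σ) : ariasC1 σ = 1 / 7 * (2 : ℝ) ^ (3 * σ / 2) := by
  simp [ariasC1, hσ]

/-- The constants are positive: `0 < c(σ)`. [cite: AriasDeReyna2011, Thm. 4.1, eq. (4.2)] -/
theorem ariasC_pos (σ : ℝ) : 0 < ariasC σ := by
  unfold ariasC
  split_ifs <;> positivity

/-- The constants are positive: `0 < b(σ)`. [cite: AriasDeReyna2011, Thm. 4.1, eq. (4.2)] -/
theorem ariasB_pos (σ : ℝ) : 0 < ariasB σ := by
  unfold ariasB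
  split_ifs
  · norm_num
  · refine Real.sqrt_pos.2 (mul_pos ?_ Real.pi_pos)
    have : Real.log 2 < 1 := by
      have := Real.log_two_lt_d9
      linarith
    linarith

/-- The constants are positive: `0 < c₁(σ)`. [cite: AriasDeReyna2011, Thm. 4.2, eq. (4.8)] -/
theorem ariasC1_pos (σ : ℝ) : 0 < ariasC1 σ := by
  unfold ariasC1
  split_ifs <;> positivity

/-- `|U| = 1`. [cite: AriasDeReyna2011, eq. (3.3)] -/
theorem norm_ariasU (t : ℝ) : ‖ariasU t‖ = 1 := by
  rw [ariasU, Complex.norm_exp]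
  simp

/-! ## Lehmer's form of the Riemann–Siegel expansion with Arias de Reyna's bounds (named fact) -/

/-- NAMED FACT (**Arias de Reyna 2011, Thm. 3.1** — Lehmer's form of the Riemann–Siegel formula for
`𝓡(s)` — **with the bounds of Thm. 4.1** (`|C_k(p)| ≤ c(σ) Γ(k/2)/b(σ)^k`, `k ≥ 1`), **Thm. 4.2**
(`|RS_K| ≤ c₁(σ) Γ((K+1)/2)/(a/1.1)^{K+1}` for `K ≥ 1` and `σ ≥ 0` or `K + σ ≥ 2`) **and
`|C₀(p)| ≤ 1/2`** (`C₀ = F`, eq. (5.2), and Thm. 6.1 with `n = 0`; Polymath 15, eq. (cop)), in the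
existential form used by Polymath 15, Prop. 6.2: for `σ` real, `t > 0`, `s = σ + it`,
`a = √(t/2π)`, `N = ⌊a⌋` and an integer `K ≥ 1` with `σ ≥ 0` or `K + σ ≥ 2`, there are complex
numbers `C₀, …, C_K` with `|C₀| ≤ 1/2`, `|C_k| ≤ c(σ) Γ(k/2)/b(σ)^k` (`1 ≤ k ≤ K`) and

  `|∫_{N↙N+1} x^{-s} e^{πix²}/(e^{πix} − e^{−πix}) dx − (−1)^{N−1} U a^{−σ} Σ_{k=0}^{K} C_k a^{−k}|`
  `  ≤ a^{−σ} c₁(σ) Γ((K+1)/2)/(a/1.1)^{K+1}`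

(`|U| = 1`; the line integral is the tree's `SiegelIntegral.rsLineIntegral (N + 1/2) s`, equal to
`𝓡(s) − Σ_{n ≤ N} n^{-s}` for `N ≥ 1` by `SiegelIntegral.riemannAux_eq_sum_add_rsLineIntegral` and to
`𝓡(s)` for `N = 0`). Weaker than the source, which identifies the coefficients (`C₀(p) = F(p)`
independent of `σ`, `C_k(p, σ)` by eqs. (3.9)/(5.1)) and bounds `C_k` for every `k ≥ 1`.
[cite: AriasDeReyna2011, Thm. 3.1 (eq. (3.11)), Thm. 4.1 (eqs. (4.1)–(4.3)), Thm. 4.2 (eqs. (4.7)–(4.8)), eq. (5.2) and Thm. 6.1]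
[cite: Polymath2019, Prop. 6.2 and eq. (cop)] -/
def arias_lehmer_rs_bound : Prop :=
  ∀ σ t : ℝ, ∀ K : ℕ, 0 < t → 1 ≤ K → (0 ≤ σ ∨ (2 : ℝ) ≤ K + σ) →
    ∃ C : ℕ → ℂ, ‖C 0‖ ≤ 1 / 2 ∧
      (∀ k : ℕ, 1 ≤ k → k ≤ K →
        ‖C k‖ ≤ ariasC σ * Real.Gamma ((k : ℝ) / 2) / ariasB σ ^ k) ∧
      ‖SiegelIntegral.rsLineIntegral (⌊Real.sqrt (t / (2 * π))⌋₊ + 1 / 2) ((σ : ℂ) + t * I) -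
          (-1 : ℂ) ^ (⌊Real.sqrt (t / (2 * π))⌋₊ + 1) * ariasU t *
            ((Real.sqrt (t / (2 * π)) : ℂ) ^ (-(σ : ℂ))) *
              ∑ k ∈ Finset.range (K + 1), C k / ((Real.sqrt (t / (2 * π)) : ℂ)) ^ k‖ ≤
        Real.sqrt (t / (2 * π)) ^ (-σ) * ariasC1 σ * Real.Gamma (((K : ℝ) + 1) / 2) /
          (Real.sqrt (t / (2 * π)) / 1.1) ^ (K + 1)

/-- The trivial case recorded for orientation: at `K`-independent level the fact yields, for every
admissible `(σ, t, K)`, the crude consequence `|∫_{N↙N+1}| ≤ a^{−σ}(Σ_{k ≤ K} |C_k| a^{−k} + c₁ Γ((K+1)/2)/(a/1.1)^{K+1})`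
by the triangle inequality and `|U| = 1`. [cite: AriasDeReyna2011, Thm. 3.1, Thm. 4.2] -/
theorem arias_lehmer_rs_bound.norm_rsLineIntegral_le (h : arias_lehmer_rs_bound) {σ t : ℝ} {K : ℕ}
    (ht : 0 < t) (hK : 1 ≤ K) (hσK : 0 ≤ σ ∨ (2 : ℝ) ≤ K + σ) :
    ∃ C : ℕ → ℂ, ‖C 0‖ ≤ 1 / 2 ∧
      ‖SiegelIntegral.rsLineIntegral (⌊Real.sqrt (t / (2 * π))⌋₊ + 1 / 2) ((σ : ℂ) + t * I)‖ ≤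
        Real.sqrt (t / (2 * π)) ^ (-σ) *
            ∑ k ∈ Finset.range (K + 1), ‖C k‖ / Real.sqrt (t / (2 * π)) ^ k +
          Real.sqrt (t / (2 * π)) ^ (-σ) * ariasC1 σ * Real.Gamma (((K : ℝ) + 1) / 2) /
            (Real.sqrt (t / (2 * π)) / 1.1) ^ (K + 1) := by
  obtain ⟨C, hC0, -, hR⟩ := h σ t K ht hK hσK
  refine ⟨C, hC0, ?_⟩
  set a : ℝ := Real.sqrt (t / (2 * π)) with ha
  have ha0 : 0 < a := Real.sqrt_pos.2 (by positivity)
  set J := SiegelIntegral.rsLineIntegral (⌊a⌋₊ + 1 / 2) ((σ : ℂ) + t * I) with hJ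
  set M := (-1 : ℂ) ^ (⌊a⌋₊ + 1) * ariasU t * ((a : ℂ) ^ (-(σ : ℂ))) *
    ∑ k ∈ Finset.range (K + 1), C k / ((a : ℂ)) ^ k with hM
  have hMn : ‖M‖ ≤ a ^ (-σ) * ∑ k ∈ Finset.range (K + 1), ‖C k‖ / a ^ k := by
    rw [hM, norm_mul, norm_mul, norm_mul, norm_pow, norm_neg, norm_one, one_pow, one_mul,
      norm_ariasU, one_mul]
    have h1 : ‖((a : ℂ) ^ (-(σ : ℂ)))‖ = a ^ (-σ) := by
      rw [Complex.norm_cpow_eq_rpow_re_of_pos ha0]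
      simp
    rw [h1]
    refine mul_le_mul_of_nonneg_left ((norm_sum_le _ _).trans (le_of_eq ?_))
      (Real.rpow_nonneg ha0.le _)
    refine Finset.sum_congr rfl fun k _ ↦ ?_
    rw [norm_div, norm_pow, Complex.norm_of_nonneg ha0.le]
  calc ‖J‖ = ‖(J - M) + M‖ := by rw [sub_add_cancel]
    _ ≤ ‖J - M‖ + ‖M‖ := norm_add_le _ _
    _ ≤ _ := by
        have := add_le_add hR hMn
        linarith [this]

/-! ## Discharge of the named fact -/

/-- **Arias de Reyna 2011, Thm. 3.1 with the bounds of Thms. 4.1, 4.2 and `|C₀| ≤ ½` — proved.** The tree's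
`AriasDeReyna*` files formalize §§2–4 of the source and the case `n = 0` of Thm. 6.1: the saddle-point form of
the integrand and its expansion (`AriasDeReynaKernel`, `…TaylorLine`, `…Expansion`: Thm. 3.1 =
`AriasDeReyna.rsLineIntegral_sub_main_eq`), the Cauchy-estimate bound for `C_k` (`…CoefficientBound`: Thm. 4.1 =
`AriasDeReyna.norm_coefC_le`), the remainder bound with the certified numerical constants of the line `L`
(`…RemainderBound`, `…LineClosedForm`, `…LinePolynomial`, `…LineNumerics`: Thm. 4.2 =
`AriasDeReyna.norm_rsLineIntegral_sub_expansion_le`), `|C₀| ≤ ½` (`…LeadingCoefficient`: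
`AriasDeReyna.norm_coefC0_le_of_pos`) and the passage to integer saddle points (`…LehmerAssembly`:
`AriasDeReyna.lehmer_expansion_bound`), with `C_k = AriasDeReyna.coef σ a k`.
[cite: AriasDeReyna2011, Thm. 3.1 (eq. (3.11)), Thm. 4.1 (eqs. (4.1)–(4.3)), Thm. 4.2 (eqs. (4.7)–(4.8)), eq. (5.2) and Thm. 6.1] -/
theorem arias_lehmer_rs_bound_holds : arias_lehmer_rs_bound := fun σ t K ht hK hσK ↦
  AriasDeReyna.lehmer_expansion_bound σ t K ht hK hσK

end Literature.NumberTheory.LFunctions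

end
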